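import Mathlib
import Summits.Ventures.LatticeQCDFlow.TrivializingMaps.Vertex

/-!
# The Casimir-graded Lüscher series, I: the data (THEORY-1 §19.3–19.4, file (5d-i))

HONEST FRAMING. Exact (Metropolis-corrected) sampling algorithms for lattice gauge theory; figures of
merit are autocorrelation/cost numbers at stated couplings and volumes; no continuum-physics claim.
This file (with `GradedSeries`) constructs ONE solution of Lüscher's flow-action recursion
(`IsLuscherSeries`) as explicit finite sums of rank-one data; it makes no convergence claim (that is
THEOREM T / file (6)).

A GENERATION `G : Gen B σ` is a finite family of data `(lnk i, pol i, z i, x i, P_{m i} v i)` on slot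
systems of shape `σ`; its function is `G.func = ∑ i termF(…)`.  Generation `0` re-grades the plaquette
terms of `S` (`gen0`, cf. `Vertex.ambWilsonAction_eq_termF`); generation `k+1 = G.step` multiplies in one
plaquette per datum, link and colour direction (`Vertex.vertex`), re-grades over the joint Casimir modes
of the tensored system (`Vertex.termF_coeConfig_eq_sum`) and divides by the Laplacian eigenvalue
`c(m') = ∑ₑ m'_e` (`RankOne.linkLap_termF_jointProj`), sending zero modes into the constants.  Here: the
structures, `gen0`, `step`, the constants, and `Δ G.func = ∑ᵢ c(mᵢ) termᵢ` (`Gen.linkLap_func`).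
[ours (bookkeeping); cite: Luscher2010Trivializing §4.3 eqs. (4.9)–(4.13)]
-/

noncomputable section

namespace Summit.Ventures.LatticeQCDFlow.TrivializingMaps.GradedSeries

open scoped ComplexConjugate Matrix Matrix.Norms.Frobenius InnerProductSpace ContDiff
open Finset
open Literature.MathematicalPhysics.QuantumFieldTheory
open Literature.MathematicalPhysics.QuantumFieldTheory.Luscher2010
open SlotRepresentation SlotCasimir SlotCoefficient SlotHilbert JointGrading CasimirGrading PlaquetteData
  SlotTensor TensorShift RankOne Vertex

variable {d L n : ℕ} [NeZero L]

/-! ## 1. Generations of data -/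

/-- A **generation**: a finite family of rank-one data on slot systems of shape `σ`.  The bra vector of
datum `i` is `P_{m i} (v i)` (`Gen.y`), a vector of the joint Casimir mode `m i`. [ours] -/
structure Gen (B : SuBasis n) (σ : Type) [Fintype σ] [DecidableEq σ] : Type 1 where
  /-- index type of the generation -/
  I : Type
  /-- it is finite -/
  instF : Fintype I
  /-- links of the slots of datum `i` -/
  lnk : I → σ → Edge d L
  /-- polarities of the slots of datum `i` -/
  pol : I → σ → Bool
  /-- complex coefficient of datum `i` -/
  z : I → ℂ
  /-- ket vector of datum `i` -/
  x : I → SlotSpace σ n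
  /-- pre-bra vector of datum `i` (the bra vector is its projection `P_{m i} v i`) -/
  v : I → SlotSpace σ n
  /-- joint Casimir mode of datum `i` -/
  m : (i : I) → Modes (casimirFamily (lnk i) (pol i) B)

attribute [instance] Gen.instF

namespace Gen
variable {B : SuBasis n} {σ : Type} [Fintype σ] [DecidableEq σ] (G : Gen (d := d) (L := L) B σ)

/-- The bra vector `y i = P_{m i} v i`. [ours] -/
def y (i : G.I) : SlotSpace σ n := jointProj (casimirFamily (G.lnk i) (G.pol i) B) (G.m i) (G.v i)

/-- The function of datum `i`. [ours] -/
def term (i : G.I) : AmbConfig d L n → ℝ := termF (G.lnk i) (G.pol i) (G.z i) (G.x i) (G.y i)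

/-- The function of the generation: `∑ᵢ termF(zᵢ, xᵢ, yᵢ)`. [ours] -/
def func : AmbConfig d L n → ℝ := fun W => ∑ i, G.term i W

/-- The Laplacian eigenvalue `c(m i)` of datum `i`. [ours] -/
def cm (i : G.I) : ℝ := modeC (G.lnk i) (G.pol i) B (G.m i)

/-- Each datum is smooth. [ours] -/
theorem contDiff_term (i : G.I) : ContDiff ℝ ∞ (G.term i) := contDiff_termF _ _ _ _ _

/-- The generation's function is smooth. [ours] -/
theorem contDiff_func : ContDiff ℝ ∞ G.func := ContDiff.sum fun i _ => G.contDiff_term i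

/-- `Δ (G.func) = ∑ᵢ c(mᵢ) termF(zᵢ, xᵢ, yᵢ)` EVERYWHERE on the ambient space. [ours] -/
theorem linkLap_func (W : AmbConfig d L n) : linkLap B G.func W = ∑ i, G.cm i * G.term i W := by
  have h := congrFun (linkLap_finset_sum B Finset.univ (fun i => G.term i) fun i _ => G.contDiff_term i) W
  rw [show G.func = fun W => ∑ i ∈ Finset.univ, G.term i W from rfl, h]
  exact Finset.sum_congr rfl fun i _ => linkLap_termF_jointProj _ _ B _ _ _ _ W

/-- `∂^a_e (G.func) = ∑ᵢ ∂^a_e termF(zᵢ, xᵢ, yᵢ)`. [ours] -/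
theorem linkDeriv_func (e : Edge d L) (a : B.ι) (W : AmbConfig d L n) :
    linkDeriv e (B.T a) G.func W = ∑ i, linkDeriv e (B.T a) (G.term i) W := by
  have h := congrFun (linkDeriv_finset_sum e (B.T a) Finset.univ (fun i => G.term i)
    fun i _ => G.contDiff_term i) W
  rw [show G.func = fun W => ∑ i ∈ Finset.univ, G.term i W from rfl, h]

end Gen

/-! ## 2. Generation 0: the re-graded plaquette terms of `S` -/

/-- Minus division by the eigenvalue: `zneg c = -1/c`, and `0` on zero modes. [ours] -/
def zneg (c : ℝ) : ℂ := if c = 0 then 0 else -((c⁻¹ : ℝ) : ℂ)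

/-- `c · zneg c = -1` off zero modes, `0` on them. [ours] -/
theorem ofReal_mul_zneg (c : ℝ) : (c : ℂ) * zneg c = if c = 0 then 0 else -1 := by
  unfold zneg
  split_ifs with h
  · simp
  · rw [mul_neg, ← Complex.ofReal_mul, mul_inv_cancel₀ h, Complex.ofReal_one]

section Gen0
variable (B : SuBasis n)

/-- Index of generation 0: plaquette `p`, colour multi-index `c`, joint mode `m` of the plaquette system.
[ours] -/
abbrev Idx0 (B : SuBasis n) : Type :=
  Σ _r : (Site d L × Fin d × Fin d) × (Fin n × Fin n × Fin n × Fin n),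
    Modes (casimirFamily (plaqIdx (d := d) (L := L) _r.1.1 _r.1.2.1 _r.1.2.2) plaqPol B)

/-- **Generation 0**: `z = -1/c(m)` (`0` on zero modes and on non-plaquettes `μ ≥ ν`), `x = P_m κ_c`,
`v = β_c`. [ours] -/
def gen0 : Gen (d := d) (L := L) B (Fin 4) where
  I := Idx0 (d := d) (L := L) B
  instF := inferInstance
  lnk := fun j => plaqIdx j.1.1.1 j.1.1.2.1 j.1.1.2.2
  pol := fun _ => plaqPol
  z := fun j => if j.1.1.2.1 < j.1.1.2.2 then zneg (modeC (plaqIdx j.1.1.1 j.1.1.2.1 j.1.1.2.2) plaqPol B j.2)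
    else 0
  x := fun j => jointProj (casimirFamily (plaqIdx j.1.1.1 j.1.1.2.1 j.1.1.2.2) plaqPol B) j.2 (pv (ketIdx j.1.2))
  v := fun j => pv (braIdx j.1.2)
  m := fun j => j.2

/-- The re-graded plaquette term of index `j`: `termF_{Q_p}(1, P_m κ_c, P_m β_c)`. [ours] -/
def baseF (j : Idx0 (d := d) (L := L) B) : AmbConfig d L n → ℝ :=
  termF ((gen0 (d := d) (L := L) B).lnk j) ((gen0 (d := d) (L := L) B).pol j) 1
    ((gen0 (d := d) (L := L) B).x j) ((gen0 (d := d) (L := L) B).y j)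

/-- The constant of generation 0: `c₀ = -(#plaquettes)·n + ∑_{zero modes} baseF(𝟙)`. [ours] -/
def const0 : ℝ :=
  -(∑ p : Site d L × Fin d × Fin d, if p.2.1 < p.2.2 then (n : ℝ) else 0)
    + ∑ j : Idx0 (d := d) (L := L) B, if j.1.1.2.1 < j.1.1.2.2 then
        (if (gen0 (d := d) (L := L) B).cm j = 0 then baseF B j (WilsonFlow.coeConfig fun _ => 1) else 0)
      else 0

/-- Sums over the generation-0 index, iterated. [ours] -/
theorem sum_Idx0 (F : Idx0 (d := d) (L := L) B → ℝ) :
    ∑ j, F j = ∑ p : Site d L × Fin d × Fin d, ∑ c : Fin n × Fin n × Fin n × Fin n,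
      ∑ mo : Modes (casimirFamily (plaqIdx (d := d) (L := L) p.1 p.2.1 p.2.2) plaqPol B), F ⟨(p, c), mo⟩ := by
  rw [Fintype.sum_sigma]
  exact Fintype.sum_prod_type _

end Gen0

/-! ## 3. The step: multiply in one plaquette, re-grade, divide by the eigenvalue -/

namespace Gen
variable {B : SuBasis n} {σ : Type} [Fintype σ] [DecidableEq σ] (G : Gen (d := d) (L := L) B σ)

/-- Links of the child system `Q_p ⊕ S_i`. [ours] -/
def clnk (i : G.I) (p : Site d L × Fin d × Fin d) : Fin 4 ⊕ σ → Edge d L :=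
  Sum.elim (plaqIdx p.1 p.2.1 p.2.2) (G.lnk i)

/-- Polarities of the child system `Q_{·,b} ⊕ S_i`. [ours] -/
def cpol (i : G.I) (b : Bool) : Fin 4 ⊕ σ → Bool := Sum.elim (polB b) (G.pol i)

/-- The joint modes of the child system `Q_{p,b} ⊕ S_i`. [ours] -/
abbrev CModes (i : G.I) (p : Site d L × Fin d × Fin d) (b : Bool) : Type :=
  Modes (casimirFamily (G.clnk i p) (G.cpol i b) B)

/-- Finiteness of the child indices, built by hand level by level (instance search does not find the
eigenvalue-set instances under nested binders). Level 6: colour index × mode. [ours] -/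
instance instFintypeL6 (i : G.I) (p : Site d L × Fin d × Fin d) (b : Bool) :
    Fintype ((Fin n × Fin n × Fin n × Fin n) × G.CModes i p b) := inferInstance

/-- Finiteness, level 5 (flip). [ours] -/
instance instFintypeL5 (i : G.I) (p : Site d L × Fin d × Fin d) :
    Fintype (Σ b : Bool, (Fin n × Fin n × Fin n × Fin n) × G.CModes i p b) :=
  @Sigma.instFintype _ _ (fun b => G.instFintypeL6 i p b) inferInstance

/-- Finiteness, level 4 (plaquette). [ours] -/
instance instFintypeL4 (i : G.I) :
    Fintype (Σ p : Site d L × Fin d × Fin d, Σ b : Bool, (Fin n × Fin n × Fin n × Fin n) × G.CModes i p b) :=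
  @Sigma.instFintype _ _ (fun p => G.instFintypeL5 i p) inferInstance

/-- Finiteness, level 3 (parent). [ours] -/
instance instFintypeL3 : Fintype (Σ i : G.I, Σ p : Site d L × Fin d × Fin d, Σ b : Bool,
    (Fin n × Fin n × Fin n × Fin n) × G.CModes i p b) :=
  @Sigma.instFintype _ _ (fun i => G.instFintypeL4 i) inferInstance

/-- Index of the next generation: link `e`, colour direction `a`, parent `i`, plaquette `p`, flip `b`,
colour multi-index `c`, joint mode of the child system. [ours] -/
abbrev CIdx : Type :=
  Σ _e : Edge d L, Σ _a : B.ι, Σ i : G.I, Σ p : Site d L × Fin d × Fin d, Σ b : Bool,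
    (Fin n × Fin n × Fin n × Fin n) × G.CModes i p b

/-- Finiteness of the child index. [ours] -/
instance instFintypeCIdx : Fintype G.CIdx :=
  @Sigma.instFintype _ _ (fun _ => @Sigma.instFintype _ _ (fun _ => G.instFintypeL3) inferInstance) inferInstance

/-- The pre-ket of a child: `κ_c ⊗ x_i`. [ours] -/
def cx (i : G.I) (c : Fin n × Fin n × Fin n × Fin n) : SlotSpace (Fin 4 ⊕ σ) n := tens (pv (ketIdx c)) (G.x i)

/-- The pre-bra of a child: `T_a^{Q_{p,b},e} β_c ⊗ T_a^{S_i,e} y_i`. [ours] -/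
def cv (e : Edge d L) (a : B.ι) (i : G.I) (p : Site d L × Fin d × Fin d) (b : Bool)
    (c : Fin n × Fin n × Fin n × Fin n) : SlotSpace (Fin 4 ⊕ σ) n :=
  tens (genCLM (plaqIdx p.1 p.2.1 p.2.2) (polB b) e (B.T a) (pv (braIdx c)))
    (genCLM (G.lnk i) (G.pol i) e (B.T a) (G.y i))

/-- The vertex coefficient of a child before division: `z_i / 2` on plaquettes `μ < ν`, else `0`. [ours] -/
def zhalf (i : G.I) (p : Site d L × Fin d × Fin d) : ℂ :=
  if p.2.1 < p.2.2 then (((1 / 2 : ℝ)) : ℂ) * G.z i else 0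

/-- Division by the eigenvalue: `zdiv c w = w / c`, and `0` on zero modes. [ours] -/
def zdiv (c : ℝ) (w : ℂ) : ℂ := if c = 0 then 0 else ((c⁻¹ : ℝ) : ℂ) * w

/-- `c · zdiv c w = w` off zero modes, `0` on them. [ours] -/
theorem ofReal_mul_zdiv (c : ℝ) (w : ℂ) : (c : ℂ) * zdiv c w = if c = 0 then 0 else w := by
  unfold zdiv
  split_ifs with h
  · simp
  · rw [← mul_assoc, ← Complex.ofReal_mul, mul_inv_cancel₀ h, Complex.ofReal_one, one_mul]

/-- **The next generation.**  For `j = ⟨e, a, i, p, b, c, m'⟩`: system `Q_{p,b} ⊕ S_i`, mode `m'`,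
`x = P_{m'}(κ_c ⊗ x_i)`, `v = T_a^{Q,e} β_c ⊗ T_a^{S,e} y_i`, `z = zhalf / c(m')`. [ours] -/
def step : Gen (d := d) (L := L) B (Fin 4 ⊕ σ) where
  I := G.CIdx
  instF := G.instFintypeCIdx
  lnk := fun j => G.clnk j.2.2.1 j.2.2.2.1
  pol := fun j => G.cpol j.2.2.1 j.2.2.2.2.1
  z := fun j => zdiv (modeC (G.clnk j.2.2.1 j.2.2.2.1) (G.cpol j.2.2.1 j.2.2.2.2.1) B j.2.2.2.2.2.2)
    (G.zhalf j.2.2.1 j.2.2.2.1)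
  x := fun j => jointProj (casimirFamily (G.clnk j.2.2.1 j.2.2.2.1) (G.cpol j.2.2.1 j.2.2.2.2.1) B) j.2.2.2.2.2.2
    (G.cx j.2.2.1 j.2.2.2.2.2.1)
  v := fun j => G.cv j.1 j.2.1 j.2.2.1 j.2.2.2.1 j.2.2.2.2.1 j.2.2.2.2.2.1
  m := fun j => j.2.2.2.2.2.2

/-- The child function before division by the eigenvalue: `termF(zhalf, P_{m'}(κ⊗x), P_{m'}(Tβ ⊗ Ty))`.
[ours] -/
def childF (j : G.CIdx) : AmbConfig d L n → ℝ :=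
  termF (G.step.lnk j) (G.step.pol j) (G.zhalf j.2.2.1 j.2.2.2.1) (G.step.x j) (G.step.y j)

/-- The constant produced by the step: minus the zero-mode children evaluated at `𝟙`. [ours] -/
def stepConst : ℝ :=
  -∑ j : G.CIdx, if G.step.cm j = 0 then G.childF j (WilsonFlow.coeConfig fun _ => 1) else 0

end Gen

end Summit.Ventures.LatticeQCDFlow.TrivializingMaps.GradedSeries
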